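import Literature.Analysis.FluidPDE.TaoH1AlmostRegularForced
import Literature.Analysis.FluidPDE.TaoH1AlmostRegularForcedScheme
import Literature.Analysis.FluidPDE.LerayEnstrophyAPrioriForced
import Literature.Analysis.FluidPDE.TaoForcedFiniteEnergyLerayHopfL2
import Literature.Analysis.FluidPDE.NSSerrinUniquenessForced
import Literature.Analysis.FluidPDE.ClassicalSolutionGlue
import Literature.Analysis.FluidPDE.ClayForceTimeShift
import Literature.Analysis.FluidPDE.TaoH1APrioriForced
import Literature.Analysis.FluidPDE.LimitLerayHopfForced
import Literature.Analysis.FluidPDE.LerayHopfRestartForced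
import Literature.Analysis.FluidPDE.MollifiedH1Data
import Literature.Analysis.FluidPDE.SmoothRepresentative
import HarnessLib

/-!
# Tao 2013, Theorem 5.4 (ii) for `H¹` data WITH FORCING: assembly from the full-slab smooth
# existence theory

Analysis/FluidPDE proof file (no named facts, no definitions). We prove the REDUCTION
`tao2011_forced_H1_local_almost_regular_of_fullSlab`: the forced smooth existence theory ON THE
WHOLE SLAB with Tao's printed `L¹_t H¹_x` lifespan (hypothesis `hP5`, the statement of the tree's
forthcoming `smooth_existence_forced_fullSlab`, itself a consequence of the theorem
`tao2011_smooth_local_existence_forced_holds` = Tao 2013, Thm. 5.4 (ii)+(iv) WITH force) implies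
the `H¹` statement `tao2011_forced_H1_local_almost_regular` (`TaoH1AlmostRegularForced.lean`;
Tao 2013, Thm. 5.4 (ii) with Lemma 5.5 / Thm. 5.4 (iii)–(iv), force of the Clay class: an `H¹`
datum with `‖u₀‖²_{H¹} ≤ A`, a force with `‖f‖_{L¹_t H¹_x} ≤ B` and `(√A + B)⁴T ≤ cν³` launch a
Leray–Hopf solution of the FORCED system on `[0, T)` which is `H¹`-regular on `[0, T]` and
classical of Tao's class on every `[τ, T]`, `τ > 0`).

The proof is the forced twin of `tao2011_H1_local_almost_regular_of_smooth_local_existence`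
(`TaoH1AlmostRegularAssembly.lean`): mollify the datum (`MollifiedH1Data.lean`, force-free), solve
classically on `[0, T]` with the common force `f` (hypothesis `hP5`), bound the enstrophies by the
forced a priori bound (`exists_leray_enstrophy_apriori_forced`, smallness `(√A + B)⁴T ≤ cν³`) and
the energies by Tao's Lemma 8.1 WITH force (`tao2011_forced_finiteEnergy_energyBound_holds`:
`‖u(t)‖₂ ≲ ‖u(0)‖₂ + ‖f‖_{L¹_t L²_x}` — the sharp form is needed, the restart below has to stay
inside the printed lifespan), get uniform bounds of all orders at positive times
(`tao2011_quantitative_regularity_clayForce`, Lemma 5.5 WITH force) and the uniform `L²`-Cauchy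
property (`uniform_cauchy_of_stability_forced`, the common force cancelling in differences), pass
to the Leray–Hopf limit WITH force (`exists_isLerayHopfOn_of_uniform_cauchy_forced`), and recover
smoothness for positive times by restarting THE FULL-SLAB THEORY (`hP5` again, for the shifted
Clay force `f(· + s)`) from a smooth representative of a slice at an a.e. good time
(`IsLerayHopfOn.ae_isLerayHopfOn_restart_forced`, `exists_smooth_h1_rep`) and forced weak–strong
uniqueness (a private copy of the tree's `exists_classical_rep_of_restart_clayForce`). `H¹`-regularity at `t = 0⁺` is the
force-free `isH1RegularOn_of_rep`, fed with the forced cubic enstrophy inequality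
(`exists_enstrophy_cubic_ineq_forced`: `∫|∇uⁿ(t)|² ≤ ∫|∇uⁿ(0)|² + L t`).

Design note. Both existence calls go through the `L¹_t H¹_x`-lifespan statement `hP5`, never
through the sup-form smallness `(A + B_∞ T)⁴T ≤ cν³` of `tao2011_smooth_local_existence_forced`:
the printed hypothesis of Thm. 5.4 (ii) does not control `B_∞ = sup_t ‖f(t)‖_{H¹}`.

## References

* T. Tao, Localisation and compactness properties of the Navier–Stokes global regularity problem,
  Anal. PDE 6 (2013) 25–107 = arXiv:1108.1165, Thm. 5.4 (i)–(v), Lemma 5.5, Prop. 5.6, Lemma 8.1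
  — all printed WITH the forcing term. [Tao2011]
* J. C. Robinson, J. L. Rodrigo, W. Sadowski, *The three-dimensional Navier–Stokes equations*,
  CUP 2016, Thm. 6.8, Cor. 6.9, Thm. 7.3, Thm. 8.17. [RobinsonRodrigoSadowski2016]
-/

noncomputable section

open MeasureTheory TopologicalSpace Set Function Filter ContinuousLinearMap
open _root_.Topology
open scoped InnerProductSpace RealInnerProductSpace ENNReal NNReal Interval ContDiff

namespace Literature.Analysis.FluidPDE

/-! ## Conversions for the force norms -/

section ForceNorms

variable {T : ℝ} {f : ℝ → (EuclideanSpace ℝ (Fin 3)) → (EuclideanSpace ℝ (Fin 3))}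

/-- Change of variables `t ↦ t + s` in a lower integral over an interval (private copy of the
tree's `setLIntegral_Ioo_comp_add_right`, outside this file's import closure). [folklore] -/
private theorem setLIntegral_Ioo_comp_add_right' (g : ℝ → ℝ≥0∞) (a b s : ℝ) :
    ∫⁻ t in Ioo a b, g (t + s) = ∫⁻ t in Ioo (a + s) (b + s), g t := by
  have h1 : ∀ t, (Ioo a b).indicator (fun t => g (t + s)) t =
      (Ioo (a + s) (b + s)).indicator g (t + s) := by
    intro t
    by_cases ht : t ∈ Ioo a b
    · rw [indicator_of_mem ht, indicator_of_mem (show t + s ∈ Ioo (a + s) (b + s) from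
        ⟨by linarith [ht.1], by linarith [ht.2]⟩)]
    · rw [indicator_of_notMem ht, indicator_of_notMem]
      rintro ⟨h₁, h₂⟩
      exact ht ⟨by linarith, by linarith⟩
  rw [← lintegral_indicator measurableSet_Ioo, ← lintegral_indicator measurableSet_Ioo]
  calc ∫⁻ t, (Ioo a b).indicator (fun t => g (t + s)) t
      = ∫⁻ t, (Ioo (a + s) (b + s)).indicator g (t + s) := lintegral_congr h1
    _ = ∫⁻ t, (Ioo (a + s) (b + s)).indicator g t :=
        lintegral_add_right_eq_self (μ := (volume : Measure ℝ)) _ s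

/-- **The `L¹_t H¹_x` bound of the shifted force**: if `∫₀ᵀ ‖f(t)‖_{H¹} dt ≤ B` then
`∫₀^{T-s} ‖f(t + s)‖_{H¹} dt ≤ B` for `0 ≤ s` (translation and monotonicity of the domain).
[folklore] -/
private theorem lintegral_eH1NormSq_rpow_shift_le {s B : ℝ} (hs : 0 ≤ s)
    (hL1 : ∫⁻ t in Ioo 0 T, eH1NormSq (f t) ^ (2⁻¹ : ℝ) ≤ ENNReal.ofReal B) :
    ∫⁻ t in Ioo 0 (T - s), eH1NormSq (f (t + s)) ^ (2⁻¹ : ℝ) ≤ ENNReal.ofReal B := by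
  rw [setLIntegral_Ioo_comp_add_right' (fun t => eH1NormSq (f t) ^ (2⁻¹ : ℝ)) 0 (T - s) s,
    zero_add, sub_add_cancel]
  exact (lintegral_mono_set (Ioo_subset_Ioo hs le_rfl)).trans hL1

/-- The `L²` size of a slice is at most its `H¹` size: `(∫⁻ ‖g‖ₑ²)^{1/2} ≤ (eH1NormSq g)^{1/2}`.
[folklore] -/
private theorem lintegral_enorm_sq_rpow_le_eH1NormSq_rpow
    (g : (EuclideanSpace ℝ (Fin 3)) → (EuclideanSpace ℝ (Fin 3))) :
    (∫⁻ x, ‖g x‖ₑ ^ 2) ^ (1 / 2 : ℝ) ≤ eH1NormSq g ^ (2⁻¹ : ℝ) := by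
  rw [one_div]
  exact ENNReal.rpow_le_rpow (by rw [eH1NormSq_def]; exact le_self_add) (by norm_num)

/-- **The `L¹_t L²_x` bound of the force from its `L¹_t H¹_x` bound** (Tao's finite-energy class
(6) from the `H¹` class): `∫_{[0,T]} (∫|f(t)|²)^{1/2} ≤ B`. [cite: Tao2011, §1 (6) p. 3] -/
theorem lintegral_Icc_sqrt_energy_le_of_eH1 {B : ℝ}
    (hL1 : ∫⁻ t in Ioo 0 T, eH1NormSq (f t) ^ (2⁻¹ : ℝ) ≤ ENNReal.ofReal B) :
    ∫⁻ t in Icc 0 T, (∫⁻ x, ‖f t x‖ₑ ^ 2) ^ (1 / 2 : ℝ) ≤ ENNReal.ofReal B := by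
  rw [← restrict_Ioo_eq_restrict_Icc]
  exact (lintegral_mono fun t => lintegral_enorm_sq_rpow_le_eH1NormSq_rpow (f t)).trans hL1

/-- **The `L¹_t L²_x` bound of the force gradient from the `L¹_t H¹_x` bound**: for `C¹` slices
with `t ↦ ∫|∇f(t)|²` continuous on `[0, T]` (`T > 0`) and `∫₀ᵀ ‖f(t)‖_{H¹} ≤ B` (`B ≥ 0`),
`∫₀ᵀ (∫|∇f(t)|²_F)^{1/2} dt ≤ B` (the gradient of a `C¹` slice computes its weak dissipation,
`eWeakGradL2Sq_eq_of_hasWeakGradient`). [cite: Tao2011, §1 p. 6 (`H¹` data)] -/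
theorem intervalIntegral_sqrt_grad_le_of_eH1 (hT : 0 < T) {B : ℝ} (hB : 0 ≤ B)
    (hf1 : ∀ t ∈ Icc 0 T, ContDiff ℝ 1 (f t))
    (hGfc : ContinuousOn (fun t => ∫ x, FluidPDE.frobeniusNormSq (fderiv ℝ (f t) x)) (Icc 0 T))
    (hGfeq : ∀ t ∈ Icc 0 T, ENNReal.ofReal (∫ x, FluidPDE.frobeniusNormSq (fderiv ℝ (f t) x)) =
      ∫⁻ x, ENNReal.ofReal (FluidPDE.frobeniusNormSq (fderiv ℝ (f t) x)))
    (hL1 : ∫⁻ t in Ioo 0 T, eH1NormSq (f t) ^ (2⁻¹ : ℝ) ≤ ENNReal.ofReal B) :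
    ∫ t in (0 : ℝ)..T, Real.sqrt (∫ x, FluidPDE.frobeniusNormSq (fderiv ℝ (f t) x)) ≤ B := by
  set g : ℝ → ℝ := fun t => Real.sqrt (∫ x, FluidPDE.frobeniusNormSq (fderiv ℝ (f t) x)) with hg
  have hg0 : ∀ t, 0 ≤ g t := fun t => Real.sqrt_nonneg _
  have hgc : ContinuousOn g (Icc 0 T) := Real.continuous_sqrt.comp_continuousOn hGfc
  have hgm : AEStronglyMeasurable g (volume.restrict (Ioc 0 T)) :=
    (hgc.aestronglyMeasurable measurableSet_Icc).mono_measure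
      (Measure.restrict_mono Ioc_subset_Icc_self le_rfl)
  -- pointwise: `ofReal (g t) ≤ (eH1NormSq (f t))^{1/2}` on `[0, T]`
  have hpt : ∀ t ∈ Icc 0 T, ENNReal.ofReal (g t) ≤ eH1NormSq (f t) ^ (2⁻¹ : ℝ) := by
    intro t ht
    have hG0 : 0 ≤ ∫ x, FluidPDE.frobeniusNormSq (fderiv ℝ (f t) x) :=
      integral_nonneg fun x => FluidPDE.frobeniusNormSq_nonneg _
    rw [hg]; dsimp only
    rw [Real.sqrt_eq_rpow, one_div, ← ENNReal.ofReal_rpow_of_nonneg hG0 (by norm_num), hGfeq t ht,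
      ← eWeakGradL2Sq_eq_of_hasWeakGradient (hasWeakGradient_fderiv_of_contDiff (hf1 t ht))]
    exact ENNReal.rpow_le_rpow (by rw [eH1NormSq_def]; exact le_add_self) (by norm_num)
  have hlin : ∫⁻ t in Ioc 0 T, ENNReal.ofReal (g t) ≤ ENNReal.ofReal B := by
    rw [← restrict_Ioo_eq_restrict_Ioc]
    exact (setLIntegral_mono' measurableSet_Ioo fun t ht => hpt t (Ioo_subset_Icc_self ht)).trans hL1
  rw [intervalIntegral.integral_of_le hT.le,
    integral_eq_lintegral_of_nonneg_ae (Eventually.of_forall fun t => hg0 t) hgm]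
  exact ENNReal.toReal_le_of_le_ofReal hB hlin

end ForceNorms

/-! ## Classical representatives from a restart (private copy) -/

section Restart

set_option maxHeartbeats 800000 in
/-- Private copy (to keep this file's import closure to built modules) of the tree's
`exists_classical_rep_of_restart_forced` / `…_clayForce` (`TaoH1AlmostRegularForcedRestart.lean`):
smooth representative on `[τ, T]` by restart and FORCED weak–strong uniqueness, for the shifted
force `f(· + s)` Schwartz on the slab `[0, T - s]` with `L²` slices `≤ C_f`; the representative
solves the system with the original force `f`. [folklore] -/
private theorem exists_classical_rep_of_restart_shifted {ν T s τ : ℝ} (hν : 0 < ν) (hsτ : s < τ)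
    (hτT : τ < T) {f : ℝ → (EuclideanSpace ℝ (Fin 3)) → (EuclideanSpace ℝ (Fin 3))}
    {Cf : ℝ≥0∞} (hCft : Cf ≠ ⊤) (hCf : ∀ t ∈ Icc 0 (T - s), ∫⁻ x, ‖f (t + s) x‖ₑ ^ 2 ≤ Cf)
    (hgS : FluidPDE.IsSmoothSpaceTimeOn (Icc 0 (T - s)) (fun t => f (t + s)))
    (hgD : FluidPDE.HasUniformRapidDecayOn (Icc 0 (T - s)) (fun t => f (t + s)))
    {v : ℝ → (EuclideanSpace ℝ (Fin 3)) → (EuclideanSpace ℝ (Fin 3))} (hvs : MemLp (v s) 2 volume)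
    (hLHs : FluidPDE.IsLerayHopfOn (T - s) ν (fun t => f (t + s)) (v s) (fun t => v (t + s)))
    {W : ℝ → (EuclideanSpace ℝ (Fin 3)) → (EuclideanSpace ℝ (Fin 3))}
    {P : ℝ → (EuclideanSpace ℝ (Fin 3)) → ℝ}
    (hW : FluidPDE.IsClassicalNSSolutionOn (Icc 0 (T - s)) ν (fun t => f (t + s)) W P)
    (hW0 : W 0 =ᵐ[volume] v s) (hWB : HasBoundedSobolevNormsOn (Icc 0 (T - s)) W)
    (hWB' : HasBoundedSobolevNormsOn (Icc 0 (T - s)) (FluidPDE.timeDerivWithin (Icc 0 (T - s)) W))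
    (hPB : ∀ n : ℕ, ∃ C : ℝ≥0, ∀ t ∈ Icc 0 (T - s), ∫⁻ x, ‖iteratedFDeriv ℝ n (P t) x‖ₑ ^ 2 ≤ C) :
    ∃ (w : ℝ → (EuclideanSpace ℝ (Fin 3)) → (EuclideanSpace ℝ (Fin 3)))
      (π : ℝ → (EuclideanSpace ℝ (Fin 3)) → ℝ),
      FluidPDE.IsClassicalNSSolutionOn (Icc τ T) ν f w π ∧ HasBoundedSobolevNormsOn (Icc τ T) w ∧
      HasBoundedSobolevNormsOn (Icc τ T) (FluidPDE.timeDerivWithin (Icc τ T) w) ∧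
      (∀ n : ℕ, ∃ C : ℝ≥0, ∀ t ∈ Icc τ T, ∫⁻ x, ‖iteratedFDeriv ℝ n (π t) x‖ₑ ^ 2 ≤ C) ∧
      (∀ t ∈ Icc τ T, v t =ᵐ[volume] w t) ∧
      ContinuousOn (fun t => ∫⁻ x, ENNReal.ofReal (FluidPDE.frobeniusNormSq (fderiv ℝ (w t) x)))
        (Icc τ T) := by
  have hTs : 0 < T - s := by linarith
  -- `W` is Leray–Hopf from `v s` for the shifted force, bounded, hence equal to the restart a.e.
  obtain ⟨C₀, hC₀⟩ := lintegral_enorm_sq_le_of_hasBoundedSobolevNormsOn hWB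
  have hLHW : FluidPDE.IsLerayHopfOn (T - s) ν (fun t => f (t + s)) (v s) W :=
    (hW.isLerayHopfOn_of_finiteEnergy_forced_L2 hν hTs hCft hCf
      ⟨C₀, ENNReal.coe_lt_top, hC₀⟩).1.congr_datum_ae hW0.symm
  obtain ⟨B, hB⟩ := linfty_bound_of_hasBoundedSobolevNormsOn_holds
    (fun t ht => (hW.contDiff_velocity ht).of_le (by norm_cast)) hWB
  have hB0 : 0 ≤ max B 0 := le_max_right _ _
  have hS : FluidPDE.MemLqLp ∞ ∞ W (Ioo 0 (T - s)) :=
    memLqLp_top_top_of_forall_norm_le measurableSet_Ioo hB0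
      (fun t ht => (hW.contDiff_velocity (Ioo_subset_Icc_self ht)).continuous)
      fun t ht x => (hB t (Ioo_subset_Icc_self ht) x).trans (le_max_left _ _)
  have hgm := hW.force_prod_aestronglyMeasurable hTs
  have hg2 := hW.force_prod_eLpNorm_two_lt_top hTs hCft hCf
  have hae : ∀ t ∈ Ioc 0 (T - s), v (t + s) =ᵐ[volume] W t :=
    serrinMasuda_weak_strong_uniqueness_forced hν hTs hgm hg2 hLHW hvs (q := ⊤) (r := ⊤) (by simp)
      (by simp) hS hLHs
  -- the translated classical solution, for the original force
  have hpre : Icc τ T ⊆ (· + -s) ⁻¹' Icc 0 (T - s) := fun t ht =>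
    ⟨by linarith [ht.1], by linarith [ht.2]⟩
  have hsolw : FluidPDE.IsClassicalNSSolutionOn (Icc τ T) ν f (fun t => W (t + -s))
      fun t => P (t + -s) := by
    have h := (hW.comp_add_right (-s)).mono hpre (uniqueDiffOn_Icc hτT)
    simpa only [neg_add_cancel_right] using h
  have htd : ∀ t ∈ Icc τ T, FluidPDE.timeDerivWithin (Icc τ T) (fun t => W (t + -s)) t =
      FluidPDE.timeDerivWithin (Icc 0 (T - s)) W (t + -s) := by
    intro t ht
    funext x
    rw [(hW.comp_add_right (-s)).smooth_velocity.timeDerivWithin_eq_of_subset hpre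
      (uniqueDiffOn_Icc hτT) ht x]
    exact timeDerivWithin_comp_add_right _ W (-s) t x
  -- continuity of the enstrophy (forced cubic enstrophy inequality, first clause)
  obtain ⟨κ, -, hcubic⟩ := exists_enstrophy_cubic_ineq_forced
  obtain ⟨hGc, -, -, -, hGeq, -⟩ := hcubic hν hTs hW hWB hWB' hPB hgS hgD
  refine ⟨fun t => W (t + -s), fun t => P (t + -s), hsolw,
    fun n => (hWB n).imp fun C hC t ht => hC (t + -s) (hpre ht),
    fun n => (hWB' n).imp fun C hC t ht => ?_,
    fun n => (hPB n).imp fun C hC t ht => hC (t + -s) (hpre ht), fun t ht => ?_, ?_⟩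
  · rw [htd t ht]; exact hC (t + -s) (hpre ht)
  · have ht' : t + -s ∈ Ioc 0 (T - s) := ⟨by linarith [ht.1], by linarith [ht.2]⟩
    have h := hae (t + -s) ht'
    rwa [neg_add_cancel_right] at h
  · have hc : ContinuousOn (fun t => ENNReal.ofReal
        (∫ x, FluidPDE.frobeniusNormSq (fderiv ℝ (W (t + -s)) x))) (Icc τ T) :=
      ENNReal.continuous_ofReal.comp_continuousOn
        (hGc.comp (continuousOn_id.add continuousOn_const) hpre)
    exact hc.congr fun t ht => (hGeq (t + -s) (hpre ht)).symm

end Restart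

/-! ## The assembly -/

section Main

set_option maxHeartbeats 3200000 in
/-- **Tao 2013, Theorem 5.4 (ii) for `H¹` data WITH FORCING, from the full-slab smooth existence
theory** (Tao 2013, Thm. 5.4 (i)–(v), Lemma 5.5, Prop. 5.6, Lemma 8.1, all WITH the forcing term;
Leray 1934, §§31–33; Robinson–Rodrigo–Sadowski 2016, Thm. 6.8 / Cor. 6.9 / Thm. 7.3 / Thm. 8.17).
Assume the full-slab forced smooth existence statement `hP5` (constant `c₅`). Let `c₂, K` be the
constants of the forced enstrophy a priori bound `exists_leray_enstrophy_apriori_forced`, `C_E`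
the constant of the forced energy bound `tao2011_forced_finiteEnergy_energyBound_holds`, and put
`c = min(c₅, c₂, c₅/(√(C_E + K) + 1)⁴)`. For an `H¹` divergence-free datum with
`‖u₀‖²_{H¹} ≤ A`, a Clay-class force with `∫₀ᵀ ‖f‖_{H¹} ≤ B` and `(√A + B)⁴T ≤ cν³`: mollify
(`mollify_h1_datum`, data of size `≤ A` in `L² ⊕ Ḣ¹`), solve classically on `[0, T]` with the
common force (`hP5`, `c ≤ c₅`), bound the enstrophies by `K(√A + B)²` (`c ≤ c₂`) and the energies
by `C_E(√A + B)²` (Lemma 8.1 with force), get all higher norms at positive times uniformly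
(`tao2011_quantitative_regularity_clayForce`), the uniform `L²`-Cauchy property
(`uniform_cauchy_of_stability_forced`) and the forced Leray–Hopf limit `v ∈ C([0,T]; L²)`
(`exists_isLerayHopfOn_of_uniform_cauchy_forced`); at an a.e. restart time `s ∈ (τ/2, τ)`
(`IsLerayHopfOn.ae_isLerayHopfOn_restart_forced`) the slice `v(s)` has a smooth `H^∞`
representative of size `≤ (C_E + K)(√A + B)²` (`exists_smooth_h1_rep`), from which the full-slab
theory restarts on `[0, T - s]` with the shifted force (`c ≤ c₅/(√(C_E+K)+1)⁴`) and reproduces `v`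
by forced weak–strong uniqueness (`exists_classical_rep_of_restart_clayForce`); `H¹`-regularity on
`[0, T]` is `isH1RegularOn_of_rep` with the forced cubic enstrophy bound
(`exists_enstrophy_cubic_ineq_forced`). [cite: Tao2011, Thm. 5.4 (ii)] -/
theorem tao2011_forced_H1_local_almost_regular_of_fullSlab
    (hP5 : ∃ c : ℝ, 0 < c ∧ ∀ ⦃ν T : ℝ⦄, 0 < ν → 0 < T →
      ∀ ⦃u₀ : (EuclideanSpace ℝ (Fin 3)) → (EuclideanSpace ℝ (Fin 3))⦄,
        ContDiff ℝ ∞ u₀ → VectorCalculus.IsDivFree u₀ →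
        (∀ n : ℕ, ∫⁻ x, ‖iteratedFDeriv ℝ n u₀ x‖ₑ ^ 2 < ⊤) →
      ∀ ⦃f : ℝ → (EuclideanSpace ℝ (Fin 3)) → (EuclideanSpace ℝ (Fin 3))⦄,
        IsSmoothOnHalfSpace f → HasRapidSpaceTimeDecay f →
      ∀ ⦃A B : ℝ⦄, 0 ≤ A → 0 ≤ B →
        (∫⁻ x, ‖u₀ x‖ₑ ^ 2) + (∫⁻ x, ENNReal.ofReal (FluidPDE.frobeniusNormSq (fderiv ℝ u₀ x))) ≤
            ENNReal.ofReal A →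
        ∫⁻ t in Ioo 0 T, eH1NormSq (f t) ^ (2⁻¹ : ℝ) ≤ ENNReal.ofReal B →
        (Real.sqrt A + B) ^ 4 * T ≤ c * ν ^ 3 →
        ∃ (u : ℝ → (EuclideanSpace ℝ (Fin 3)) → (EuclideanSpace ℝ (Fin 3)))
          (p : ℝ → (EuclideanSpace ℝ (Fin 3)) → ℝ),
          FluidPDE.IsClassicalNSSolutionOn (Icc 0 T) ν f u p ∧ u 0 = u₀ ∧
          HasBoundedSobolevNormsOn (Icc 0 T) u ∧
          HasBoundedSobolevNormsOn (Icc 0 T) (FluidPDE.timeDerivWithin (Icc 0 T) u) ∧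
          (∀ n : ℕ, ∃ C : ℝ≥0, ∀ t ∈ Icc 0 T, ∫⁻ x, ‖iteratedFDeriv ℝ n (p t) x‖ₑ ^ 2 ≤ C) ∧
          FluidPDE.ContinuousInLpOn (Icc 0 T) 2 u) :
    tao2011_forced_H1_local_almost_regular := by
  obtain ⟨c₅, hc₅, hslab⟩ := hP5
  obtain ⟨c₂, K, hc₂, hK, hPB⟩ := exists_leray_enstrophy_apriori_forced
  obtain ⟨κ, hκ, hcubic⟩ := exists_enstrophy_cubic_ineq_forced
  obtain ⟨CE, hCEtop, hEB⟩ := tao2011_forced_finiteEnergy_energyBound_holds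
  set cE : ℝ := CE.toReal with hcE_def
  have hcE0 : 0 ≤ cE := ENNReal.toReal_nonneg
  have hCEeq : CE = ENNReal.ofReal cE := (ENNReal.ofReal_toReal hCEtop.ne).symm
  set R : ℝ := (Real.sqrt (cE + K) + 1) ^ 4 with hR_def
  have hR1 : 1 ≤ R := one_le_pow₀ (by linarith [Real.sqrt_nonneg (cE + K)])
  have hR0 : 0 < R := lt_of_lt_of_le one_pos hR1
  set c : ℝ := min (min c₅ c₂) (c₅ / R) with hc_def
  have hcpos : 0 < c := lt_min (lt_min hc₅ hc₂) (div_pos hc₅ hR0)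
  have hcc₅ : c ≤ c₅ := (min_le_left _ _).trans (min_le_left _ _)
  have hcc₂ : c ≤ c₂ := (min_le_left _ _).trans (min_le_right _ _)
  have hcR : c ≤ c₅ / R := min_le_right _ _
  refine ⟨c, hcpos, ?_⟩
  intro ν T hν hT u₀ hu₀ hdiv f hfs hfd A B hA hB hH1 hL1 hsmall
  have h0I : (0 : ℝ) ∈ Icc 0 T := left_mem_Icc.2 hT.le
  have hU : UniqueDiffOn ℝ (Icc 0 T) := uniqueDiffOn_Icc hT
  have hν3 : 0 < ν ^ 3 := pow_pos hν 3
  set Mr : ℝ := Real.sqrt A + B with hMr_def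
  have hMr0 : 0 ≤ Mr := add_nonneg (Real.sqrt_nonneg _) hB
  have hKA : 0 ≤ K * Mr ^ 2 := by positivity
  -- Step 0: the weak gradient of the datum
  obtain ⟨G₀, hG₀, -⟩ := exists_hasWeakGradient_of_eH1NormSq_lt (hH1.trans_lt ENNReal.ofReal_lt_top)
  have hWG : eWeakGradL2Sq u₀ = ∫⁻ x, ENNReal.ofReal (FluidPDE.frobeniusNormSq (G₀ x)) :=
    eWeakGradL2Sq_eq_of_hasWeakGradient hG₀
  have hsum : FluidPDE.eEnergy u₀ + ∫⁻ x, ENNReal.ofReal (FluidPDE.frobeniusNormSq (G₀ x)) ≤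
      ENNReal.ofReal A := by
    rw [← hWG, ← eH1NormSq_def]; exact hH1
  have hE0 : FluidPDE.eEnergy u₀ ≤ ENNReal.ofReal A := le_self_add.trans hsum
  have hG0A : ∫⁻ x, ENNReal.ofReal (FluidPDE.frobeniusNormSq (G₀ x)) ≤ ENNReal.ofReal A :=
    le_add_self.trans hsum
  have hG0top : ∫⁻ x, ENNReal.ofReal (FluidPDE.frobeniusNormSq (G₀ x)) < ⊤ :=
    hG0A.trans_lt ENNReal.ofReal_lt_top
  -- Step 0': the force on the slab
  have hfS : FluidPDE.IsSmoothSpaceTimeOn (Icc 0 T) f := hfs.isSmoothSpaceTimeOn_Icc T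
  have hfD : FluidPDE.HasUniformRapidDecayOn (Icc 0 T) f := hfd.hasUniformRapidDecayOn_Icc hfs hT
  obtain ⟨F0, hF0⟩ := hfd.exists_lintegral_iteratedFDeriv_slice_sq_le_all (μ := volume) hfs 0
  have hCf : ∀ t ∈ Icc 0 T, ∫⁻ x, ‖f t x‖ₑ ^ 2 ≤ (F0 : ℝ≥0∞) := by
    intro t ht
    refine (le_of_eq (lintegral_congr fun x => ?_)).trans (hF0 t ht.1)
    rw [← ofReal_norm, ← ofReal_norm, norm_iteratedFDeriv_zero]
  have hCfs : ∀ {s : ℝ}, 0 ≤ s → ∀ t ∈ Icc 0 (T - s), ∫⁻ x, ‖f (t + s) x‖ₑ ^ 2 ≤ (F0 : ℝ≥0∞) := by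
    intro s hs t ht
    refine (le_of_eq (lintegral_congr fun x => ?_)).trans (hF0 (t + s) (by linarith [ht.1]))
    rw [← ofReal_norm, ← ofReal_norm, norm_iteratedFDeriv_zero]
  have hCft : (F0 : ℝ≥0∞) ≠ ⊤ := ENNReal.coe_ne_top
  have hfL2 : ∀ t ∈ Icc 0 T, ∫⁻ x, ‖f t x‖ₑ ^ 2 < ⊤ := fun t ht =>
    (hCf t ht).trans_lt ENNReal.coe_lt_top
  have hfEB : ∫⁻ t in Icc 0 T, (∫⁻ x, ‖f t x‖ₑ ^ 2) ^ (1 / 2 : ℝ) ≤ ENNReal.ofReal B :=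
    lintegral_Icc_sqrt_energy_le_of_eH1 hL1
  have hfE : ∫⁻ t in Icc 0 T, (∫⁻ x, ‖f t x‖ₑ ^ 2) ^ (1 / 2 : ℝ) < ⊤ :=
    hfEB.trans_lt ENNReal.ofReal_lt_top
  -- Step 1: mollified data
  obtain ⟨φ, hφ, -⟩ := exists_mollify_seq_tendsto hu₀ hG₀ hG0top
  have hdat := fun n => mollify_h1_datum (φ n) hu₀ hdiv hG₀
  have hdatA : ∀ n, (∫⁻ x, ‖mollify (φ n) u₀ x‖ₑ ^ 2) +
      (∫⁻ x, ENNReal.ofReal (FluidPDE.frobeniusNormSq (fderiv ℝ (mollify (φ n) u₀) x))) ≤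
        ENNReal.ofReal A :=
    fun n => (add_le_add (hdat n).2.2.2.1 (hdat n).2.2.2.2).trans hsum
  have hsmall₅ : (Real.sqrt A + B) ^ 4 * T ≤ c₅ * ν ^ 3 :=
    hsmall.trans (mul_le_mul_of_nonneg_right hcc₅ hν3.le)
  have hsmall₂ : (Real.sqrt A + B) ^ 4 * T ≤ c₂ * ν ^ 3 :=
    hsmall.trans (mul_le_mul_of_nonneg_right hcc₂ hν3.le)
  -- Step 2: classical approximants on the whole slab `[0, T]`, common force `f`
  have hex : ∀ n, ∃ (u : ℝ → (EuclideanSpace ℝ (Fin 3)) → (EuclideanSpace ℝ (Fin 3)))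
      (p : ℝ → (EuclideanSpace ℝ (Fin 3)) → ℝ),
      FluidPDE.IsClassicalNSSolutionOn (Icc 0 T) ν f u p ∧ u 0 = mollify (φ n) u₀ ∧
      HasBoundedSobolevNormsOn (Icc 0 T) u ∧
      HasBoundedSobolevNormsOn (Icc 0 T) (FluidPDE.timeDerivWithin (Icc 0 T) u) ∧
      (∀ k : ℕ, ∃ C : ℝ≥0, ∀ t ∈ Icc 0 T, ∫⁻ x, ‖iteratedFDeriv ℝ k (p t) x‖ₑ ^ 2 ≤ C) ∧
      FluidPDE.ContinuousInLpOn (Icc 0 T) 2 u :=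
    fun n => hslab hν hT (hdat n).1 (hdat n).2.1 (hdat n).2.2.1 hfs hfd hA hB (hdatA n) hL1 hsmall₅
  choose u p hsol hu0 huB huB' hpB huc using hex
  have hmem : ∀ n, ∀ t ∈ Icc 0 T, MemLp (u n t) 2 volume := fun n => (huc n).1
  -- Step 3: the cubic enstrophy inequality and the force gradient
  have hcub := fun n => hcubic hν hT (hsol n) (huB n) (huB' n) (hpB n) hfS hfD
  obtain ⟨-, hGfc, -, -, -, hGfeq⟩ := hcub 0
  have hBgrad : ∫ t in (0 : ℝ)..T, Real.sqrt (∫ x, FluidPDE.frobeniusNormSq (fderiv ℝ (f t) x)) ≤ B :=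
    intervalIntegral_sqrt_grad_le_of_eH1 hT hB
      (fun t ht => contDiff_infty.1 (hfS.contDiff_slice ht) 1) hGfc hGfeq hL1
  obtain ⟨Gf₁, hGf₁⟩ := isCompact_Icc.exists_bound_of_continuousOn hGfc
  have hGf₁' : ∀ t ∈ Icc 0 T, ∫ x, FluidPDE.frobeniusNormSq (fderiv ℝ (f t) x) ≤ Gf₁ := fun t ht =>
    (le_abs_self _).trans ((Real.norm_eq_abs _).symm.le.trans (hGf₁ t ht))
  have hGf₁0 : 0 ≤ Gf₁ := (integral_nonneg fun x => FluidPDE.frobeniusNormSq_nonneg _).trans (hGf₁' 0 h0I)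
  -- Step 3': the enstrophy a priori bound
  have hgrad0 : ∀ n, ∫⁻ x, ENNReal.ofReal (FluidPDE.frobeniusNormSq (fderiv ℝ (u n 0) x)) ≤
      ENNReal.ofReal A := fun n => by
    rw [hu0 n]; exact (hdat n).2.2.2.2.trans hG0A
  have hPBn : ∀ n, (∀ t ∈ Icc 0 T, ∫⁻ x, ENNReal.ofReal (FluidPDE.frobeniusNormSq (fderiv ℝ (u n t) x)) ≤
      ENNReal.ofReal (K * Mr ^ 2)) ∧ ENNReal.ofReal ν * ∫⁻ t in Ioo 0 T, ∫⁻ x,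
        ‖iteratedFDeriv ℝ 2 (u n t) x‖ₑ ^ 2 ≤ ENNReal.ofReal (K * Mr ^ 2) :=
    fun n => hPB hν hT (hsol n) (huB n) (huB' n) (hpB n) hfS hfD hA hB (hgrad0 n) hBgrad hsmall₂
  have hensE : ∀ n, ∀ t ∈ Icc 0 T,
      ∫⁻ x, ENNReal.ofReal (FluidPDE.frobeniusNormSq (fderiv ℝ (u n t) x)) ≤
        (((K * Mr ^ 2).toNNReal : ℝ≥0) : ℝ≥0∞) :=
    fun n => (hPBn n).1
  have hensR : ∀ n, ∀ t ∈ Icc 0 T, ∫ x, FluidPDE.frobeniusNormSq (fderiv ℝ (u n t) x) ≤ K * Mr ^ 2 := by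
    intro n t ht
    obtain ⟨-, -, -, -, hGeq, -⟩ := hcub n
    have h := (hPBn n).1 t ht
    rw [← hGeq t ht] at h
    exact (ENNReal.ofReal_le_ofReal_iff hKA).1 h
  -- Step 4: energies of the approximants (Lemma 8.1 WITH force)
  set Eb : ℝ := cE * Mr ^ 2 with hEb_def
  have hEb0 : 0 ≤ Eb := by positivity
  have hEn : ∀ n, ∀ t ∈ Icc 0 T, ∫⁻ x, ‖u n t x‖ₑ ^ 2 ≤ ENNReal.ofReal Eb := by
    intro n
    obtain ⟨C₀, hC₀⟩ := lintegral_enorm_sq_le_of_hasBoundedSobolevNormsOn (huB n)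
    obtain ⟨hb, -⟩ := hEB hν hT (hsol n) hfS hfE ⟨C₀, hC₀⟩
    intro t ht
    refine (hb t ht).trans ?_
    have h1 : (∫⁻ x, ‖u n 0 x‖ₑ ^ 2) ^ (1 / 2 : ℝ) ≤ ENNReal.ofReal (Real.sqrt A) := by
      have h0 : ∫⁻ x, ‖u n 0 x‖ₑ ^ 2 ≤ ENNReal.ofReal A := by
        rw [hu0 n]; exact (hdat n).2.2.2.1.trans hE0
      rw [Real.sqrt_eq_rpow, ← ENNReal.ofReal_rpow_of_nonneg hA (by norm_num)]
      exact ENNReal.rpow_le_rpow h0 (by norm_num)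
    calc CE * ((∫⁻ x, ‖u n 0 x‖ₑ ^ 2) ^ (1 / 2 : ℝ) +
          ∫⁻ t in Icc 0 T, (∫⁻ x, ‖f t x‖ₑ ^ 2) ^ (1 / 2 : ℝ)) ^ 2
        ≤ ENNReal.ofReal cE * (ENNReal.ofReal (Real.sqrt A) + ENNReal.ofReal B) ^ 2 := by
          rw [hCEeq]; gcongr
      _ = ENNReal.ofReal Eb := by
          rw [← ENNReal.ofReal_add (Real.sqrt_nonneg _) hB, ← ENNReal.ofReal_pow hMr0,
            ← ENNReal.ofReal_mul hcE0]
  have hkin : ∀ n, ∀ t ∈ Icc 0 T, VectorCalculus.kineticEnergy (u n t) ≤ Eb / 2 := by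
    intro n t ht
    have h1 : FluidPDE.eEnergy (u n t) ≤ ENNReal.ofReal Eb := hEn n t ht
    rw [FluidPDE.eEnergy_eq_ofReal _ (hmem n t ht)] at h1
    have := (ENNReal.ofReal_le_ofReal_iff hEb0).1 h1
    linarith
  have h0' : Tendsto (fun n => eLpNorm (u n 0 - u₀) 2 volume) atTop (𝓝 0) := by
    have heq : (fun n => eLpNorm (u n 0 - u₀) 2 volume) = fun n => eLpNorm (mollify (φ n) u₀ - u₀) 2 volume :=
      funext fun n => by rw [hu0 n]
    rw [heq]; exact hφ
  -- Step 5: the uniform Cauchy property and the forced Leray–Hopf limit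
  have hcau := uniform_cauchy_of_stability_forced hν hT hsol hfL2 huB huB' hpB huc hensR hu₀ h0'
  obtain ⟨v, hLH, hv0, hcv, hconv⟩ := exists_isLerayHopfOn_of_uniform_cauchy_forced hν hT hsol huc
    hCft hCf hu₀ h0' hcau (M := Eb / 2) hkin (S := (K * Mr ^ 2).toNNReal) hensE
  -- Step 6: uniform bounds of all orders at positive times (Lemma 5.5 WITH force)
  have hE : ∀ n, ∀ t ∈ Icc 0 T, ∫⁻ x, ‖u n t x‖ₑ ^ 2 ≤ ((Eb.toNNReal : ℝ≥0) : ℝ≥0∞) := fun n t ht =>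
    hEn n t ht
  have hI : ∀ n, ∫⁻ t in Ioo 0 T, ∫⁻ x, ‖iteratedFDeriv ℝ 2 (u n t) x‖ₑ ^ 2 ≤
      (((K * Mr ^ 2 / ν).toNNReal : ℝ≥0) : ℝ≥0∞) := by
    intro n
    have hν' : ENNReal.ofReal ν ≠ 0 := (ENNReal.ofReal_pos.2 hν).ne'
    have h3 : ∫⁻ t in Ioo 0 T, ∫⁻ x, ‖iteratedFDeriv ℝ 2 (u n t) x‖ₑ ^ 2 ≤
        ENNReal.ofReal (K * Mr ^ 2) / ENNReal.ofReal ν := by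
      rw [ENNReal.le_div_iff_mul_le (Or.inl hν') (Or.inl ENNReal.ofReal_ne_top), mul_comm]
      exact (hPBn n).2
    refine h3.trans (le_of_eq ?_)
    rw [← ENNReal.ofReal_div_of_pos hν]
    rfl
  have hPA : ∀ τ' : ℝ, 0 < τ' → τ' < T → ∀ k : ℕ, ∃ C : ℝ≥0, ∀ n, ∀ t ∈ Icc τ' T,
      ∫⁻ x, ‖iteratedFDeriv ℝ k (u n t) x‖ₑ ^ 2 ≤ C := by
    intro τ' hτ' hτ'T k
    obtain ⟨C, hC⟩ := tao2011_quantitative_regularity_clayForce k hν hτ' hτ'T Eb.toNNReal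
      (K * Mr ^ 2).toNNReal (K * Mr ^ 2 / ν).toNNReal hfs hfd
    exact ⟨C, fun n t ht => hC (hsol n) (hE n) (hensE n) (hI n) t ht⟩
  -- Step 7: classical representatives on `[τ, T]`
  have hfm := (hsol 0).force_prod_aestronglyMeasurable hT
  have hf2 := (hsol 0).force_prod_eLpNorm_two_lt_top hT hCft hCf
  have hgood : ∀ᵐ s ∂(volume.restrict (Ioo 0 T)),
      FluidPDE.IsLerayHopfOn (T - s) ν (fun t => f (t + s)) (v s) (fun t => v (t + s)) :=
    hLH.ae_isLerayHopfOn_restart_forced hν.le hfm hf2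
  have hclaim : ∀ τ ∈ Ioo 0 T, ∃ (w : ℝ → (EuclideanSpace ℝ (Fin 3)) → (EuclideanSpace ℝ (Fin 3)))
      (π : ℝ → (EuclideanSpace ℝ (Fin 3)) → ℝ),
      FluidPDE.IsClassicalNSSolutionOn (Icc τ T) ν f w π ∧ HasBoundedSobolevNormsOn (Icc τ T) w ∧
      HasBoundedSobolevNormsOn (Icc τ T) (FluidPDE.timeDerivWithin (Icc τ T) w) ∧
      (∀ n : ℕ, ∃ C : ℝ≥0, ∀ t ∈ Icc τ T, ∫⁻ x, ‖iteratedFDeriv ℝ n (π t) x‖ₑ ^ 2 ≤ C) ∧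
      (∀ t ∈ Icc τ T, v t =ᵐ[volume] w t) ∧
      ContinuousOn (fun t => ∫⁻ x, ENNReal.ofReal (FluidPDE.frobeniusNormSq (fderiv ℝ (w t) x)))
        (Icc τ T) := by
    intro τ hτ
    have hτ2 : 0 < τ / 2 := by linarith [hτ.1]
    have hτ2T : τ / 2 < T := by linarith [hτ.2]
    choose Cb hCb using hPA (τ / 2) hτ2 hτ2T
    -- a good restart time in `(τ/2, τ)`
    obtain ⟨s, hs, hLHs⟩ := exists_mem_Ioo_of_ae_restrict (show τ / 2 < τ by linarith [hτ.1])
      (ae_restrict_of_ae_restrict_of_subset (Ioo_subset_Ioo hτ2.le hτ.2.le) hgood)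
    have hsI : s ∈ Icc 0 T := ⟨by linarith [hs.1], by linarith [hs.2, hτ.2]⟩
    have hs0 : 0 ≤ s := hsI.1
    have hsτ' : s ∈ Icc (τ / 2) T := ⟨hs.1.le, hsI.2⟩
    -- the smooth `H¹` representative of `v s`
    obtain ⟨g, hg1, hgdiv, hgfin, hgae, hgH1⟩ := exists_smooth_h1_rep (u := u) (s := s) (v := v)
      (fun n => (hsol n).contDiff_velocity hsI) (fun n => (hsol n).divFree s hsI)
      (fun n => hmem n s hsI) (Cb := Cb) (fun k n => hCb k n s hsτ') (hcv.1 s hsI) (hconv s hsI)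
      (Sb := ENNReal.ofReal (K * Mr ^ 2)) ENNReal.ofReal_ne_top (fun n => (hPBn n).1 s hsI)
    have hEs : FluidPDE.eEnergy (v s) ≤ ENNReal.ofReal Eb := by
      have hk : VectorCalculus.kineticEnergy (v s) ≤ Eb / 2 :=
        le_of_tendsto' (tendsto_kineticEnergy_of_tendsto_eLpNorm_sub (fun n => hmem n s hsI)
          (hcv.1 s hsI) (hconv s hsI)) fun n => hkin n s hsI
      rw [FluidPDE.eEnergy_eq_ofReal _ (hcv.1 s hsI)]
      exact ENNReal.ofReal_le_ofReal (by linarith)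
    set A₁ : ℝ := (cE + K) * Mr ^ 2 with hA₁_def
    have hA₁0 : 0 ≤ A₁ := by positivity
    have hgA : (∫⁻ x, ‖g x‖ₑ ^ 2) +
        (∫⁻ x, ENNReal.ofReal (FluidPDE.frobeniusNormSq (fderiv ℝ g x))) ≤ ENNReal.ofReal A₁ := by
      refine hgH1.trans ?_
      rw [hA₁_def, show (cE + K) * Mr ^ 2 = Eb + K * Mr ^ 2 by rw [hEb_def]; ring,
        ENNReal.ofReal_add hEb0 hKA]
      exact add_le_add hEs le_rfl
    have hTs : 0 < T - s := by linarith [hs.2, hτ.2]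
    -- the smallness for the restart: `(√A₁ + B)⁴ (T - s) ≤ c₅ ν³`
    have hsqrtA₁ : Real.sqrt A₁ = Real.sqrt (cE + K) * Mr := by
      rw [hA₁_def, Real.sqrt_mul (by positivity) (Mr ^ 2), Real.sqrt_sq hMr0]
    have hle₁ : Real.sqrt A₁ + B ≤ (Real.sqrt (cE + K) + 1) * Mr := by
      rw [hsqrtA₁, add_mul, one_mul]
      have : B ≤ Mr := by rw [hMr_def]; linarith [Real.sqrt_nonneg A]
      linarith
    have hsmall' : (Real.sqrt A₁ + B) ^ 4 * (T - s) ≤ c₅ * ν ^ 3 := by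
      have h4 : (Real.sqrt A₁ + B) ^ 4 ≤ ((Real.sqrt (cE + K) + 1) * Mr) ^ 4 :=
        pow_le_pow_left₀ (add_nonneg (Real.sqrt_nonneg _) hB) hle₁ 4
      calc (Real.sqrt A₁ + B) ^ 4 * (T - s) ≤ ((Real.sqrt (cE + K) + 1) * Mr) ^ 4 * T :=
            mul_le_mul h4 (by linarith) hTs.le (by positivity)
        _ = R * (Mr ^ 4 * T) := by rw [hR_def]; ring
        _ ≤ R * (c * ν ^ 3) := mul_le_mul_of_nonneg_left hsmall hR0.le
        _ ≤ R * (c₅ / R * ν ^ 3) := by gcongr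
        _ = c₅ * ν ^ 3 := by field_simp
    -- the restart of the full-slab theory with the shifted force
    have hL1s : ∫⁻ t in Ioo 0 (T - s), eH1NormSq (f (t + s)) ^ (2⁻¹ : ℝ) ≤ ENNReal.ofReal B :=
      lintegral_eH1NormSq_rpow_shift_le hs0 hL1
    obtain ⟨W, P, hW, hW0, hWB, hWB', hPB', -⟩ := hslab hν hTs hg1 hgdiv hgfin
      (hfs.timeShift hs0) (hfd.timeShift hfs hs0) hA₁0 hB hgA hL1s hsmall'
    have hW0' : W 0 =ᵐ[volume] v s := by rw [hW0]; exact hgae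
    exact exists_classical_rep_of_restart_shifted hν hs.2 hτ.2 hCft (hCfs hs0)
      (hfs.isSmoothSpaceTimeOn_Icc_timeShift hs0 (T - s))
      (hfd.hasUniformRapidDecayOn_Icc_timeShift hfs hs0 hTs) (hcv.1 s hsI) hLHs hW hW0' hWB hWB'
      hPB'
  -- Step 8: `H¹`-regularity
  set D₀ : ℝ := (∫⁻ x, ENNReal.ofReal (FluidPDE.frobeniusNormSq (G₀ x))).toReal with hD₀def
  have hD₀ : eWeakGradL2Sq (v 0) = ENNReal.ofReal D₀ := by
    rw [hv0, hWG, hD₀def, ENNReal.ofReal_toReal hG0top.ne]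
  set Sr : ℝ := K * Mr ^ 2 with hSr_def
  set L : ℝ := κ * (ν ^ 3)⁻¹ * Sr ^ 3 + 2 * Real.sqrt Sr * Real.sqrt Gf₁ with hL_def
  have hL0 : 0 ≤ L := by positivity
  have hup : ∀ t ∈ Icc 0 T, eWeakGradL2Sq (v t) ≤ ENNReal.ofReal (D₀ + L * t) := by
    intro t ht
    have hlsc := eWeakGradL2Sq_le_liminf_of_tendsto_eLpNorm
      (fun n => contDiff_infty.1 ((hsol n).contDiff_velocity ht) 1) (fun n => hmem n t ht) (hcv.1 t ht)
      (hconv t ht) ((liminf_le_of_frequently_le' (Frequently.of_forall fun n => (hPBn n).1 t ht)).trans_lt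
        ENNReal.ofReal_lt_top)
    refine hlsc.trans (liminf_le_of_frequently_le' (Frequently.of_forall fun n => ?_))
    obtain ⟨-, -, hcubn, -, hGeq, -⟩ := hcub n
    rw [← hGeq t ht]
    refine ENNReal.ofReal_le_ofReal ((hcubn t ht).trans ?_)
    have h1 : ∫ x, FluidPDE.frobeniusNormSq (fderiv ℝ (u n 0) x) ≤ D₀ := by
      rw [hD₀def, ← ENNReal.ofReal_le_iff_le_toReal hG0top.ne, hGeq 0 h0I, hu0 n]
      exact (hdat n).2.2.2.2
    have hG0 : ∀ τ, τ ∈ Icc 0 T → 0 ≤ ∫ x, FluidPDE.frobeniusNormSq (fderiv ℝ (u n τ) x) :=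
      fun τ _ => integral_nonneg fun x => FluidPDE.frobeniusNormSq_nonneg _
    have h2 : ∫ τ in (0 : ℝ)..t, (κ * (ν ^ 3)⁻¹ * (∫ x, FluidPDE.frobeniusNormSq (fderiv ℝ (u n τ) x)) ^ 3 +
        2 * Real.sqrt (∫ x, FluidPDE.frobeniusNormSq (fderiv ℝ (u n τ) x)) *
          Real.sqrt (∫ x, FluidPDE.frobeniusNormSq (fderiv ℝ (f τ) x))) ≤ L * t := by
      have hb : ∀ τ ∈ Ι (0 : ℝ) t,
          ‖κ * (ν ^ 3)⁻¹ * (∫ x, FluidPDE.frobeniusNormSq (fderiv ℝ (u n τ) x)) ^ 3 +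
            2 * Real.sqrt (∫ x, FluidPDE.frobeniusNormSq (fderiv ℝ (u n τ) x)) *
              Real.sqrt (∫ x, FluidPDE.frobeniusNormSq (fderiv ℝ (f τ) x))‖ ≤ L := by
        intro τ hτ
        rw [uIoc_of_le ht.1] at hτ
        have hτI : τ ∈ Icc 0 T := ⟨hτ.1.le, hτ.2.trans ht.2⟩
        have hGτ := hG0 τ hτI
        have hκν : 0 ≤ κ * (ν ^ 3)⁻¹ := mul_nonneg hκ.le (inv_nonneg.2 hν3.le)
        have hnn : 0 ≤ κ * (ν ^ 3)⁻¹ * (∫ x, FluidPDE.frobeniusNormSq (fderiv ℝ (u n τ) x)) ^ 3 +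
            2 * Real.sqrt (∫ x, FluidPDE.frobeniusNormSq (fderiv ℝ (u n τ) x)) *
              Real.sqrt (∫ x, FluidPDE.frobeniusNormSq (fderiv ℝ (f τ) x)) := by positivity
        rw [Real.norm_of_nonneg hnn, hL_def]
        refine add_le_add ?_ ?_
        · exact mul_le_mul_of_nonneg_left (pow_le_pow_left₀ hGτ (hensR n τ hτI) 3) hκν
        · have hs1 : Real.sqrt (∫ x, FluidPDE.frobeniusNormSq (fderiv ℝ (u n τ) x)) ≤ Real.sqrt Sr :=
            Real.sqrt_le_sqrt (hensR n τ hτI)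
          have hs2 : Real.sqrt (∫ x, FluidPDE.frobeniusNormSq (fderiv ℝ (f τ) x)) ≤ Real.sqrt Gf₁ :=
            Real.sqrt_le_sqrt (hGf₁' τ hτI)
          have := mul_le_mul hs1 hs2 (Real.sqrt_nonneg _) (Real.sqrt_nonneg _)
          linarith
      have h := intervalIntegral.norm_integral_le_of_norm_le_const hb
      rw [sub_zero, abs_of_nonneg ht.1] at h
      exact (le_abs_self _).trans ((Real.norm_eq_abs _).symm.le.trans h)
    exact add_le_add h1 h2
  have hrep' : ∀ τ ∈ Ioo 0 T, ∃ w : ℝ → (EuclideanSpace ℝ (Fin 3)) → (EuclideanSpace ℝ (Fin 3)),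
      (∀ t ∈ Icc τ T, ContDiff ℝ 1 (w t)) ∧
      (∀ t ∈ Icc τ T, v t =ᵐ[volume] w t) ∧
      ContinuousOn (fun t => ∫⁻ x, ENNReal.ofReal (FluidPDE.frobeniusNormSq (fderiv ℝ (w t) x)))
        (Icc τ T) := by
    intro τ hτ
    obtain ⟨w, π, hw, -, -, -, hae, hcont⟩ := hclaim τ hτ
    exact ⟨w, fun t ht => contDiff_infty.1 (hw.contDiff_velocity ht) 1, hae, hcont⟩
  have hH1 : IsH1RegularOn (Icc 0 T) v := isH1RegularOn_of_rep hT hcv hrep' hD₀ hup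
  -- conclusion
  refine ⟨v, hLH, hv0, hH1, fun τ hτ => ?_⟩
  obtain ⟨w, π, h1, h2, h3, h4, h5, -⟩ := hclaim τ hτ
  exact ⟨w, π, h1, h2, h3, h4, h5⟩

end Main

end Literature.Analysis.FluidPDE

end
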